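import Summits.QuantumFields.YangMills.Theorems.FlatTubeReductionUnitLadder
import Summits.QuantumFields.YangMills.Theorems.FemtoCutoffLadderUpStepEvGlueEx

/-!
# UpStepEv (stmt-QuantumFields-26796, shared crux of routes FemtoCutoffLadder r5 / FlatTubeReduction r6) — skeleton «two-engines»
(planner ym-idea-1 g6; rung R2b1 = RECORD label; no summit is proved by any line)

TWO registered one-stub engines, either of which closes the crux through LANDED glue (the lead picks; both stay keyed):
* `stub_unitUpStep : UnitUpStep` (= item stmt-QuantumFields-27556 BY NAME — LINE g6-A «unit-slab ladder»: the variational up-step on the UNIT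
  pair (L′, L′+1) with budget exp(C·Λ²/L′)); composition = the telescoping glue `FlatTubeReduction.UnitLadder.upStepEv_of_unitUpStep` (p628897).
* `stub_pinnedUpStepEx : PinnedUpStepEx` (= item stmt-QuantumFields-27379 BY NAME — g5 «pinned-ex»: octave-wide sub-octave pairs, budget e^{CΛ²});
  composition = `upStepEv_of_pinnedUpStepEx` (p624204).  (This file supersedes HOME/UpStepEv_engineEx.lean, whose single stub it keeps verbatim.)
-/

namespace Summit.QuantumFields.YangMills.Cruxes.UpStepEv.TwoEngines

open Summit.QuantumFields.YangMills.Theses.FlatTubeReduction (UnitUpStep)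
open Summit.QuantumFields.YangMills.Theses.FemtoCutoffLadder (PinnedUpStepEx UpStepEv)

/-- STUB A (L–XL; engine item 27561 `PinnedUnitStepEx`, skeleton «ti-split-1»). -/
theorem stub_unitUpStep : UnitUpStep := by
  sorry

/-- STUB B (XL; engine skeleton «ti-split» on 27379). -/
theorem stub_pinnedUpStepEx : PinnedUpStepEx := by
  sorry

/-- Kernel-checked composition (engine A): the crux `UpStepEv` (26796, FCL decl; the FTR copy has the same body). -/
theorem UpStepEv_holds_of_stubs : UpStepEv :=
  Summit.QuantumFields.YangMills.Theorems.FlatTubeReduction.UnitLadder.fcl_upStepEv_of_unitUpStep stub_unitUpStep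

/-- Composition (engine B). -/
theorem UpStepEv_holds_of_pinnedEx : UpStepEv :=
  Summit.QuantumFields.YangMills.Theorems.FemtoCutoffLadder.upStepEv_of_pinnedUpStepEx stub_pinnedUpStepEx

/-- FTR copy of the crux from engine A. -/
theorem ftr_UpStepEv_holds_of_stubs : Summit.QuantumFields.YangMills.Theses.FlatTubeReduction.UpStepEv :=
  Summit.QuantumFields.YangMills.Theorems.FlatTubeReduction.UnitLadder.upStepEv_of_unitUpStep stub_unitUpStep

end Summit.QuantumFields.YangMills.Cruxes.UpStepEv.TwoEngines
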